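import Mathlib
import HarnessLib
import Literature.Analysis.FluidPDE.SelfSimilar
import Literature.Analysis.FluidPDE.AxisymmetricEuler
import Literature.Analysis.FluidPDE.SelfSimilarLiouville
import Literature.Analysis.FluidPDE.KNSSThm53OfWindow
import Literature.Analysis.FluidPDE.MildSolutionIsometryCovariance

/-!
# Axisymmetric ancient mild solutions with Type I space–time decay are trivial

A corollary of the tree's PROVED Koch–Nadirashvili–Seregin–Šverák Liouville theorem under the bound
`|u| ≤ C/r` (`knss_bound_C_over_r_holds`, KNSS 2009 Thm. 5.3): an ancient mild solution of
Navier–Stokes (`ν = 1`) on `ℝ³ × (−∞, 0)` with measurable slices, axisymmetric about the `x₃`-axis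
at every `t < 0`, and obeying the Type I space–time decay `‖u(t, x)‖ ≤ C₀ / (‖x‖ + √(−t))`
(`HasTypeIDecay`), vanishes a.e. on every slice. Proof: for `s < 0` the time-translate
`t ↦ u (t + s)` is a BOUNDED ancient mild solution (bound `C₀/√(−s)`), axisymmetric, with
`r ‖u‖ ≤ C₀` (`r ≤ ‖x‖`), so KNSS Thm. 5.3 applies; `s` is arbitrary. This is the mechanism behind
"axisymmetric singularities are of Type II" (KNSS 2009, §1 and §6; Seregin–Šverák 2009, Thm. 1.1).

Consequences recorded here: the rotated Type I `λ`-DSS Liouville statement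
(`RotatedTypeIDSSLiouville`, Bradshaw–Tsai Open Problem 5.1) HOLDS in the axisymmetric class for
every factor and every rotation; equivalently a nontrivial Type I (rotated-)DSS ancient mild profile
— the object produced by blow-up constructions through Type I DSS profiles — is never axisymmetric.

Any axis (appended): the class (ancient mild, measurable slices, Type I decay) is
`O(3)`-invariant (`IsAncientMildSolution.conj_linearIsometryEquiv`,
`HasTypeIDecay.conj_linearIsometryEquiv`, `MildSolutionIsometryCovariance.lean`; KNSS 2009, §1),
so the same conclusions hold for fields axisymmetric about an arbitrary axis `A e₃`, `A` a linear
isometry of `ℝ³` — i.e. with `IsAxisymmetric (A⁻¹ ∘ u t ∘ A)` —: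
`IsAncientMildSolution.ae_eq_zero_of_isAxisymmetric_conj_of_hasTypeIDecay`,
`rotatedTypeIDSSLiouville_of_isAxisymmetric_conj`, `not_typeI_rdss_profile_of_isAxisymmetric_conj`.

WHAT THIS IS NOT: not a statement about non-axisymmetric fields; nothing here bears on the open
Liouville conjecture for bounded ancient mild solutions. [cite: KochNadirashviliSereginSverak2009, Thm 5.3, §6]
-/

namespace Literature.Analysis.FluidPDE

open MeasureTheory Set Filter

/-- The distance to the `x₃`-axis is at most the distance to the origin (private helper). [folklore] -/
private theorem cylRadius_le_norm_self (x : EuclideanSpace ℝ (Fin 3)) : cylRadius x ≤ ‖x‖ := by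
  rw [cylRadius, EuclideanSpace.norm_eq]
  apply Real.sqrt_le_sqrt
  have h : ∑ i : Fin 3, ‖x i‖ ^ 2 = x 0 ^ 2 + x 1 ^ 2 + x 2 ^ 2 := by
    simp [Fin.sum_univ_three, Real.norm_eq_abs, sq_abs]
  rw [h]
  nlinarith [sq_nonneg (x 2)]

/-- **Axisymmetric ancient mild solutions with Type I space–time decay vanish** (corollary of
KNSS 2009, Thm. 5.3 = `knss_bound_C_over_r_holds`): if `u` is an ancient mild solution (`ν = 1`)
with measurable slices, axisymmetric at every `t < 0`, and `‖u(t,x)‖ ≤ C₀/(‖x‖ + √(−t))`, then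
`u(t) = 0` a.e. for every `t < 0`. [cite: KochNadirashviliSereginSverak2009, Thm 5.3 and §6] -/
theorem IsAncientMildSolution.ae_eq_zero_of_isAxisymmetric_of_hasTypeIDecay
    {u : ℝ → EuclideanSpace ℝ (Fin 3) → EuclideanSpace ℝ (Fin 3)}
    (hu : IsAncientMildSolution 1 u) (hmeas : ∀ t < 0, AEStronglyMeasurable (u t) volume)
    (haxi : ∀ t < 0, IsAxisymmetric (u t)) {C₀ : ℝ} (hdec : HasTypeIDecay C₀ u) :
    ∀ t < 0, u t =ᵐ[volume] 0 := by
  intro t ht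
  -- translate by `s = t/2 < 0`: `v τ = u (τ + s)` is bounded by `C₀ / √(-s)` on `τ < 0`
  set s : ℝ := t / 2 with hs_def
  have hs : s < 0 := by rw [hs_def]; linarith
  have hC₀ : 0 ≤ C₀ := by
    -- the decay bound at `(s, 0)` is `‖u s 0‖ ≤ C₀ / √(-s)` with a positive denominator
    have h := hdec s hs 0
    have hden : 0 < ‖(0 : EuclideanSpace ℝ (Fin 3))‖ + Real.sqrt (-s) := by
      rw [norm_zero, zero_add]; exact Real.sqrt_pos.2 (by linarith)
    have : 0 ≤ C₀ / (‖(0 : EuclideanSpace ℝ (Fin 3))‖ + Real.sqrt (-s)) := (norm_nonneg _).trans h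
    exact (div_nonneg_iff.1 this).elim (fun h' => h'.1) fun h' => absurd h'.2 (not_le.2 hden)
  set v : ℝ → EuclideanSpace ℝ (Fin 3) → EuclideanSpace ℝ (Fin 3) := fun τ => u (τ + s) with hv_def
  have hv_anc : IsAncientMildSolution 1 v := hu.time_translate hs.le
  have hv_bdd : IsBoundedAncientMildSolution 1 v := by
    refine ⟨hv_anc, C₀ / Real.sqrt (-s), fun τ hτ x => ?_⟩
    have hτs : τ + s < 0 := by have := mem_Iio.1 hτ; linarith
    have h := hdec (τ + s) hτs x
    have hsqrt : Real.sqrt (-s) ≤ ‖x‖ + Real.sqrt (-(τ + s)) := by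
      have h1 : Real.sqrt (-s) ≤ Real.sqrt (-(τ + s)) :=
        Real.sqrt_le_sqrt (by have := mem_Iio.1 hτ; linarith)
      linarith [norm_nonneg x]
    have hspos : 0 < Real.sqrt (-s) := Real.sqrt_pos.2 (by linarith)
    calc ‖v τ x‖ = ‖u (τ + s) x‖ := rfl
      _ ≤ C₀ / (‖x‖ + Real.sqrt (-(τ + s))) := h
      _ ≤ C₀ / Real.sqrt (-s) := div_le_div_of_nonneg_left hC₀ hspos hsqrt
  have hv_meas : ∀ τ < 0, AEStronglyMeasurable (v τ) volume :=
    fun τ hτ => hmeas (τ + s) (by linarith)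
  have hv_axi : ∀ τ < 0, IsAxisymmetric (v τ) := fun τ hτ => haxi (τ + s) (by linarith)
  have hv_r : ∃ C : ℝ, ∀ τ < 0, ∀ x, cylRadius x * ‖v τ x‖ ≤ C := by
    refine ⟨C₀, fun τ hτ x => ?_⟩
    have hτs : τ + s < 0 := by linarith
    have h := hdec (τ + s) hτs x
    have hden : 0 < ‖x‖ + Real.sqrt (-(τ + s)) := by
      have := Real.sqrt_pos.2 (show 0 < -(τ + s) by linarith); linarith [norm_nonneg x]
    have hr : cylRadius x ≤ ‖x‖ + Real.sqrt (-(τ + s)) :=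
      (cylRadius_le_norm_self x).trans (le_add_of_nonneg_right (Real.sqrt_nonneg _))
    calc cylRadius x * ‖v τ x‖ ≤ cylRadius x * (C₀ / (‖x‖ + Real.sqrt (-(τ + s)))) :=
          mul_le_mul_of_nonneg_left h (cylRadius_nonneg x)
      _ ≤ (‖x‖ + Real.sqrt (-(τ + s))) * (C₀ / (‖x‖ + Real.sqrt (-(τ + s)))) :=
          mul_le_mul_of_nonneg_right hr (div_nonneg hC₀ hden.le)
      _ = C₀ := by field_simp
  -- KNSS Thm 5.3 (proved in the tree) on the translate, at time `τ = t - s = t/2 < 0`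
  have key := knss_bound_C_over_r_holds hv_bdd hv_meas hv_axi hv_r (t - s) (by rw [hs_def]; linarith)
  have : v (t - s) = u t := by simp [hv_def]
  rw [this] at key
  exact key

/-- **The rotated Type I DSS Liouville statement holds in the axisymmetric class**: for every
factor `c` and every linear isometry `R`, an ancient mild solution with measurable slices which is
rotated `c`-DSS with a Type I bound AND axisymmetric at every `t < 0` vanishes — the DSS structure
is not even used. (Bradshaw–Tsai Open Problem 5.1 restricted to axisymmetric fields.) [cite: KochNadirashviliSereginSverak2009, Thm 5.3 and §6] -/
theorem rotatedTypeIDSSLiouville_of_isAxisymmetric (c : ℝ)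
    (R : EuclideanSpace ℝ (Fin 3) ≃ₗᵢ[ℝ] EuclideanSpace ℝ (Fin 3))
    (u : ℝ → EuclideanSpace ℝ (Fin 3) → EuclideanSpace ℝ (Fin 3))
    (hu : IsAncientMildSolution 1 u) (hmeas : ∀ t < 0, AEStronglyMeasurable (u t) volume)
    (_hdss : IsRotatedDSS c R u) (hdec : ∃ C₀ : ℝ, HasTypeIDecay C₀ u)
    (haxi : ∀ t < 0, IsAxisymmetric (u t)) : ∀ t < 0, u t =ᵐ[volume] 0 := by
  obtain ⟨C₀, hC⟩ := hdec
  exact hu.ae_eq_zero_of_isAxisymmetric_of_hasTypeIDecay hmeas haxi hC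

/-- **No axisymmetric Type I rotated-DSS profile.** The profile conjunction consumed by blow-up
constructions through Type I DSS profiles (ancient mild, measurable slices, rotated DSS with factor
`c' > 1`, Type I decay, NOT a.e. zero) is never satisfied by a field axisymmetric at every `t < 0`.
[cite: KochNadirashviliSereginSverak2009, Thm 5.3 and §6] -/
theorem not_isAxisymmetric_typeI_rdss_profile :
    ¬ ∃ (c' : ℝ) (R' : EuclideanSpace ℝ (Fin 3) ≃ₗᵢ[ℝ] EuclideanSpace ℝ (Fin 3))
        (v : ℝ → EuclideanSpace ℝ (Fin 3) → EuclideanSpace ℝ (Fin 3)),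
        1 < c' ∧ IsAncientMildSolution 1 v ∧ (∀ t < 0, AEStronglyMeasurable (v t) volume) ∧
          IsRotatedDSS c' R' v ∧ (∃ C : ℝ, HasTypeIDecay C v) ∧ ¬ (∀ t < 0, v t =ᵐ[volume] 0) ∧
          (∀ t < 0, IsAxisymmetric (v t)) := by
  rintro ⟨c', R', v, -, hmild, hmeas, hdss, hdec, hnz, haxi⟩
  exact hnz (rotatedTypeIDSSLiouville_of_isAxisymmetric c' R' v hmild hmeas hdss hdec haxi)

/-! ### Any axis

Rotations about the axis `ℓ = A e₃` (`A` a linear isometry of `ℝ³`) are the conjugates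
`A R_θ A⁻¹`; a field `v` is equivariant under all of them iff `A⁻¹ ∘ v ∘ A` is `IsAxisymmetric`.
The hypotheses (ancient mild, measurable slices, Type I space–time decay) and the conclusion
(`u t =ᵐ 0`) are invariant under `u ↦ A⁻¹ u(t, A ·)` (`MildSolutionIsometryCovariance.lean`), so
the `x₃`-axis theorems above hold verbatim for every axis (KNSS 2009, §1: the problem is
invariant under the symmetries of the equations; Thm 5.3 is stated for the `x₃`-axis w.l.o.g.). -/

/-- **Axisymmetric (about any axis) ancient mild solutions with Type I space–time decay vanish**:
if `u` is an ancient mild solution (`ν = 1`) with measurable slices and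
`‖u(t,x)‖ ≤ C₀/(‖x‖ + √(−t))`, and for some linear isometry `A` of `ℝ³` every slice
`A⁻¹ ∘ u t ∘ A`, `t < 0`, is axisymmetric about the `x₃`-axis (i.e. `u t` is axisymmetric about
the axis `A e₃`), then `u(t) = 0` a.e. for every `t < 0` — `A⁻¹ u(t, A ·)` satisfies the
hypotheses of `IsAncientMildSolution.ae_eq_zero_of_isAxisymmetric_of_hasTypeIDecay`
(KNSS 2009, Thm 5.3 via `knss_bound_C_over_r_holds`), and a.e.-vanishing transports back. [cite: KochNadirashviliSereginSverak2009, Thm 5.3 and §6] -/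
theorem IsAncientMildSolution.ae_eq_zero_of_isAxisymmetric_conj_of_hasTypeIDecay
    {u : ℝ → EuclideanSpace ℝ (Fin 3) → EuclideanSpace ℝ (Fin 3)}
    (hu : IsAncientMildSolution 1 u) (hmeas : ∀ t < 0, AEStronglyMeasurable (u t) volume)
    (A : EuclideanSpace ℝ (Fin 3) ≃ₗᵢ[ℝ] EuclideanSpace ℝ (Fin 3))
    (haxi : ∀ t < 0, IsAxisymmetric (fun x => A.symm (u t (A x)))) {C₀ : ℝ}
    (hdec : HasTypeIDecay C₀ u) : ∀ t < 0, u t =ᵐ[volume] 0 := by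
  -- `w = A⁻¹ u(t, A ·)` is ancient mild, has measurable slices, Type I decay, and is axisymmetric
  have hw := (hu.conj_linearIsometryEquiv A.symm).ae_eq_zero_of_isAxisymmetric_of_hasTypeIDecay
    (fun t ht => aestronglyMeasurable_conj_linearIsometryEquiv A.symm (hmeas t ht))
    (by simpa only [LinearIsometryEquiv.symm_symm] using haxi)
    (hdec.conj_linearIsometryEquiv A.symm)
  intro t ht
  -- transport `w t =ᵐ 0` back along `u t = A w(t, A⁻¹ ·)`
  have h1 := ae_eq_zero_conj_linearIsometryEquiv A (hw t ht)
  simpa only [LinearIsometryEquiv.symm_symm, LinearIsometryEquiv.apply_symm_apply] using h1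

/-- **The rotated Type I DSS Liouville statement holds in the axisymmetric-about-any-axis class**:
for every factor `c`, every linear isometry `R` and every axis `A e₃`, an ancient mild solution with
measurable slices which is rotated `c`-DSS with a Type I bound and whose slices are axisymmetric
about `A e₃` vanishes (the DSS structure is not used). [cite: KochNadirashviliSereginSverak2009, Thm 5.3 and §6] -/
theorem rotatedTypeIDSSLiouville_of_isAxisymmetric_conj (c : ℝ)
    (R : EuclideanSpace ℝ (Fin 3) ≃ₗᵢ[ℝ] EuclideanSpace ℝ (Fin 3))
    (u : ℝ → EuclideanSpace ℝ (Fin 3) → EuclideanSpace ℝ (Fin 3))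
    (hu : IsAncientMildSolution 1 u) (hmeas : ∀ t < 0, AEStronglyMeasurable (u t) volume)
    (_hdss : IsRotatedDSS c R u) (hdec : ∃ C₀ : ℝ, HasTypeIDecay C₀ u)
    (A : EuclideanSpace ℝ (Fin 3) ≃ₗᵢ[ℝ] EuclideanSpace ℝ (Fin 3))
    (haxi : ∀ t < 0, IsAxisymmetric (fun x => A.symm (u t (A x)))) :
    ∀ t < 0, u t =ᵐ[volume] 0 := by
  obtain ⟨C₀, hC⟩ := hdec
  exact hu.ae_eq_zero_of_isAxisymmetric_conj_of_hasTypeIDecay hmeas A haxi hC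

/-- **No Type I rotated-DSS profile is axisymmetric about any axis.** The profile conjunction
consumed by blow-up constructions through Type I DSS profiles (ancient mild, measurable slices,
rotated DSS with factor `c' > 1`, Type I decay, NOT a.e. zero) is never satisfied by a field whose
slices `t < 0` are all axisymmetric about one common axis `A e₃`. [cite: KochNadirashviliSereginSverak2009, Thm 5.3 and §6] -/
theorem not_typeI_rdss_profile_of_isAxisymmetric_conj :
    ¬ ∃ (c' : ℝ) (R' : EuclideanSpace ℝ (Fin 3) ≃ₗᵢ[ℝ] EuclideanSpace ℝ (Fin 3))
        (v : ℝ → EuclideanSpace ℝ (Fin 3) → EuclideanSpace ℝ (Fin 3)),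
        1 < c' ∧ IsAncientMildSolution 1 v ∧ (∀ t < 0, AEStronglyMeasurable (v t) volume) ∧
          IsRotatedDSS c' R' v ∧ (∃ C : ℝ, HasTypeIDecay C v) ∧ ¬ (∀ t < 0, v t =ᵐ[volume] 0) ∧
          ∃ A : EuclideanSpace ℝ (Fin 3) ≃ₗᵢ[ℝ] EuclideanSpace ℝ (Fin 3),
            ∀ t < 0, IsAxisymmetric (fun x => A.symm (v t (A x))) := by
  rintro ⟨c', R', v, -, hmild, hmeas, hdss, hdec, hnz, A, haxi⟩
  exact hnz (rotatedTypeIDSSLiouville_of_isAxisymmetric_conj c' R' v hmild hmeas hdss hdec A haxi)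

end Literature.Analysis.FluidPDE
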